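import Summits.ResolutionOfSingularities.ResolutionOfSingularities.Theorems.FrobeniusClosingNoPeriodicIsolatedAtomConeAlgebraAux1
import Summits.ResolutionOfSingularities.ResolutionOfSingularities.Theorems.WildConesConeExitCriticalPlane
import Summits.ResolutionOfSingularities.ResolutionOfSingularities.Theorems.WildConesConeExitFaceDictionary

/-!
# Cone algebra for `NoPeriodicIsolatedAtom` / line `ridge_rank` — ROOM: a ridge state has `dL c + 2 ≤ n`

Part 1 (the cone datum `cone p c` of the mirror calculus; its coefficients are the degree-`p` cleaned
coefficients, `WildConesConeExit.critPlane_coeff_cone`): no constant term, every monomial of degree `p`, no Frobenius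
monomial `X_l^p` among the cleaned ones; killing `X_i` only sees the `u_i`-free coefficients
(`kill_cone_congr`); and the bridge `Linv p c =` its own span (`coe_span_Linv`, from `span_linv_eq_self`).

Part 2 (**ROOM**, theorem `room`): if `cone p c ≠ 0` (an `OrdP` witness) then the invariance space
`L = Linv p c` has codimension `≥ 2`. Otherwise `L ⊇` a hyperplane `Σ a_l w_l = 0` with `a_{j₀} = 1`
(`exists_hyperplane_le`), i.e. the vectors `e_k - a_k e_{j₀}` (`k ≠ j₀`) lie in `L`; peeling them off
the identity substitution `X = Σ_{k ≠ j₀} X_k (e_k - a_k e_{j₀}) + (Σ_l a_l X_l) e_{j₀}` (`linv_peel`, then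
homogeneity along the last line, `aeval_smul_line`) writes `cone p c` as a FROBENIUS FORM `Σ γ_l X_l^p`
(characteristic `p`), which has no cleaned monomial — contradiction.
-/

noncomputable section

-- single-problem summit: the doubled namespace component is forced by the tree layout
set_option linter.dupNamespace false

namespace Summit.ResolutionOfSingularities.ResolutionOfSingularities.Theorems.NoPeriodicIsolatedAtom.RidgeRank

open scoped BigOperators Classical
open MvPolynomial
open Summit.ResolutionOfSingularities.ResolutionOfSingularities.Theorems.ConeExit.Negative


variable {n : ℕ} {κ : Type} [Field κ]

/-- The cone datum has no constant term (`p ≠ 0`). [folklore] -/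
theorem constantCoeff_cone (p : ℕ) (hp : p ≠ 0) (c : (Fin n → ℕ) → κ) : constantCoeff (cone p c) = 0 := by
  rw [constantCoeff_eq, WildConesConeExit.critPlane_coeff_cone, if_neg]
  simp only [Finsupp.coe_zero, Pi.zero_apply, Finset.sum_const_zero]
  exact fun h => hp h.symm

/-- Every monomial of the cone datum has degree `p`. [folklore] -/
theorem degree_of_coeff_cone_ne_zero (p : ℕ) (c : (Fin n → ℕ) → κ) (m : Fin n →₀ ℕ)
    (h : coeff m (cone p c) ≠ 0) : Finsupp.degree m = p := by
  rw [WildConesConeExit.critPlane_coeff_cone] at h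
  by_cases hs : ∑ j, m j = p
  · rw [Finsupp.degree_eq_sum]; exact hs
  · rw [if_neg hs] at h; exact absurd rfl h

/-- The exponent of a nonzero cleaned coefficient is not a pure `p`-th power `X_l^p`. [folklore] -/
theorem single_ne_of_clean_ne_zero (p : ℕ) (c : (Fin n → ℕ) → κ) (A : Fin n → ℕ) (hA : clean p c A ≠ 0)
    (l : Fin n) : Finsupp.single l p ≠ Finsupp.equivFunOnFinite.symm A := by
  intro hl
  apply hA (WildConesConeExit.faceDict_clean_of_dvd p c A ?_)
  intro j
  have hj : A j = Finsupp.single l p j := by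
    rw [hl]; exact (congrFun (Finsupp.coe_equivFunOnFinite_symm A) j).symm
  rw [hj, Finsupp.single_apply]
  split_ifs
  · exact dvd_rfl
  · exact dvd_zero p

/-- **Killing `X_i` only sees the `u_i`-free degree-`p` coefficients**: if `c'` and `c` have the same
cleaned coefficients at exponents `A` with `A i = 0`, `|A| = p`, then `cone p c'|_{X_i=0} = cone p c|_{X_i=0}`.
[folklore] -/
theorem kill_cone_congr (p : ℕ) (c c' : (Fin n → ℕ) → κ) (i : Fin n)
    (H : ∀ A : Fin n → ℕ, A i = 0 → Finset.sum Finset.univ (fun j => A j) = p → clean p c' A = clean p c A) :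
    aeval (fun j : Fin n => if j = i then (0 : MvPolynomial (Fin n) κ) else X j) (cone p c') =
      aeval (fun j : Fin n => if j = i then (0 : MvPolynomial (Fin n) κ) else X j) (cone p c) := by
  -- killing `X_i` on a monomial: it survives iff `X_i` does not occur
  have hkill : ∀ (A : Fin n → ℕ) (a : κ),
      aeval (fun j : Fin n => if j = i then (0 : MvPolynomial (Fin n) κ) else X j)
        (monomial (Finsupp.equivFunOnFinite.symm A) a) =
        if A i = 0 then monomial (Finsupp.equivFunOnFinite.symm A) a else 0 := by
    intro A a
    rw [aeval_monomial, Finsupp.prod_pow, algebraMap_eq]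
    simp only [Finsupp.coe_equivFunOnFinite_symm]
    by_cases hAi : A i = 0
    · rw [if_pos hAi]
      have : (fun j => (if j = i then (0 : MvPolynomial (Fin n) κ) else X j) ^ A j) = fun j => X j ^ A j := by
        funext j
        by_cases hj : j = i
        · subst hj; simp [hAi]
        · simp [hj]
      rw [this, monomial_eq, Finsupp.prod_pow]
      simp only [Finsupp.coe_equivFunOnFinite_symm]
    · rw [if_neg hAi, Finset.prod_eq_zero (Finset.mem_univ i) (by simp [zero_pow hAi]), mul_zero]
  unfold cone
  rw [map_sum, map_sum]
  refine Finset.sum_congr rfl fun A _ => ?_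
  by_cases hs : ∑ j, A j = p
  · rw [if_pos hs, if_pos hs, hkill, hkill]
    by_cases hi : A i = 0
    · rw [if_pos hi, if_pos hi, H A hi hs]
    · rw [if_neg hi, if_neg hi]
  · rw [if_neg hs, if_neg hs]

/-- Membership in the mirror's `Linv` is the invariance identity for `cone p c` (definitional).
[folklore] -/
theorem mem_Linv_iff (p : ℕ) (c : (Fin n → ℕ) → κ) (w : Fin n → κ) :
    w ∈ Linv p c ↔
      aeval (fun j : Fin n => (X (some j) : MvPolynomial (Option (Fin n)) κ) + C (w j) * X none) (cone p c) =
        rename some (cone p c) + C (eval w (cone p c)) * (X none) ^ p :=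
  Iff.rfl

/-- **`Linv p c` is a subspace**: it equals (the carrier of) its own span (`p ≠ 0`). [folklore] -/
theorem coe_span_Linv (p : ℕ) (hp : p ≠ 0) (c : (Fin n → ℕ) → κ) :
    (Submodule.span κ (Linv p c) : Set (Fin n → κ)) = Linv p c :=
  span_linv_eq_self p (cone p c) (constantCoeff_cone p hp c)

/-- Membership in the span of `Linv p c` is the invariance identity (`p ≠ 0`). [folklore] -/
theorem mem_span_Linv_iff (p : ℕ) (hp : p ≠ 0) (c : (Fin n → ℕ) → κ) (w : Fin n → κ) :
    w ∈ Submodule.span κ (Linv p c) ↔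
      aeval (fun j : Fin n => (X (some j) : MvPolynomial (Option (Fin n)) κ) + C (w j) * X none) (cone p c) =
        rename some (cone p c) + C (eval w (cone p c)) * (X none) ^ p := by
  rw [← SetLike.mem_coe, coe_span_Linv p hp c]
  rfl



/-- A subspace of `κⁿ` of dimension `≥ n - 1` contains all `e_k - a_k e_{j₀}` (`k ≠ j₀`) for some `j₀`
and some coefficient vector `a` with `a j₀ = 1` (`n ≥ 1`). [folklore] -/
theorem exists_hyperplane_le {n : ℕ} {κ : Type} [Field κ] (hn : 0 < n) (W : Submodule κ (Fin n → κ))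
    (hW : n ≤ Module.finrank κ W + 1) :
    ∃ (j₀ : Fin n) (a : Fin n → κ), a j₀ = 1 ∧
      ∀ k, k ≠ j₀ → (fun l => (if k = l then (1 : κ) else 0) - a k * (if j₀ = l then 1 else 0)) ∈ W := by
  by_cases htop : W = ⊤
  · refine ⟨⟨0, hn⟩, fun l => if (⟨0, hn⟩ : Fin n) = l then 1 else 0, by simp, fun k _ => ?_⟩
    rw [htop]; exact Submodule.mem_top
  · obtain ⟨f, hf0, hWf⟩ := Submodule.exists_le_ker_of_lt_top W (lt_top_iff_ne_top.mpr htop)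
    have hex : ∃ j₀ : Fin n, f (fun l => if j₀ = l then 1 else 0) ≠ 0 := by
      by_contra hall
      push Not at hall
      apply hf0
      refine LinearMap.ext fun x => ?_
      rw [LinearMap.pi_apply_eq_sum_univ f x]
      simp [hall]
    obtain ⟨j₀, hj₀⟩ := hex
    refine ⟨j₀, fun k => f (fun l => if k = l then 1 else 0) / f (fun l => if j₀ = l then 1 else 0),
      div_self hj₀, fun k _ => ?_⟩
    have hker : W = LinearMap.ker f := by
      apply Submodule.eq_of_le_of_finrank_le hWf
      have h1 := LinearMap.finrank_range_add_finrank_ker f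
      rw [Module.finrank_fin_fun] at h1
      have h2 : 1 ≤ Module.finrank κ (LinearMap.range f) := by
        rw [Nat.one_le_iff_ne_zero]
        intro h0
        apply hf0
        exact LinearMap.range_eq_bot.mp (Submodule.finrank_eq_zero.mp h0)
      omega
    rw [hker, LinearMap.mem_ker]
    have : (fun l => (if k = l then (1 : κ) else 0) -
        f (fun l => if k = l then 1 else 0) / f (fun l => if j₀ = l then 1 else 0) * (if j₀ = l then 1 else 0)) =
        (fun l => if k = l then (1 : κ) else 0) -
          (f (fun l => if k = l then 1 else 0) / f (fun l => if j₀ = l then 1 else 0)) •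
            (fun l => if j₀ = l then (1 : κ) else 0) := by
      funext l
      simp only [Pi.sub_apply, Pi.smul_apply, smul_eq_mul]
    rw [this, map_sub, map_smul, smul_eq_mul, div_mul_cancel₀ _ hj₀, sub_self]

/-- **ROOM.** A state with an `OrdP` witness (a nonzero cleaned coefficient in degree `p`) has
`dL p c + 2 ≤ n`. [cite: Hironaka1970AdditiveGroups, Thm 2] -/
theorem room : ∀ p : ℕ, p.Prime → ∀ (n : ℕ) (κ : Type) [Field κ] [CharP κ p] (c : (Fin n → ℕ) → κ),
    (∃ A, clean p c A ≠ 0 ∧ Finset.sum Finset.univ (fun j => A j) = p) → dL p c + 2 ≤ n := by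
  intro p hp n κ _ _ c hOrd
  obtain ⟨A, hA, hAs⟩ := hOrd
  haveI : Fact p.Prime := ⟨hp⟩
  -- the witness exponent
  obtain ⟨m, hm⟩ : ∃ m : Fin n →₀ ℕ, m = Finsupp.equivFunOnFinite.symm A := ⟨_, rfl⟩
  have hmA : (⇑m : Fin n → ℕ) = A := by rw [hm]; exact Finsupp.coe_equivFunOnFinite_symm A
  have hcoeff : coeff m (cone p c) = clean p c A := by
    rw [WildConesConeExit.critPlane_coeff_cone, hmA, if_pos hAs]
  have hnot : ∀ l : Fin n, Finsupp.single l p ≠ m := by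
    rw [hm]; exact single_ne_of_clean_ne_zero p c A hA
  have hn : 0 < n := by
    rcases Nat.eq_zero_or_pos n with h0 | h0
    · subst h0
      rw [Finset.univ_eq_empty, Finset.sum_empty] at hAs
      exact absurd hAs.symm hp.ne_zero
    · exact h0
  by_contra hlt
  push Not at hlt
  unfold dL at hlt
  obtain ⟨j₀, a, ha₀, hb⟩ := exists_hyperplane_le hn (Submodule.span κ (Linv p c)) (by omega)
  -- the peeled vectors `b k = e_k - a_k e_{j₀}` satisfy the invariance identity
  obtain ⟨b, hb_def⟩ : ∃ b : Fin n → Fin n → κ,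
      b = fun k l => (if k = l then (1 : κ) else 0) - a k * (if j₀ = l then 1 else 0) := ⟨_, rfl⟩
  have hbL : ∀ k ∈ Finset.univ.erase j₀,
      aeval (fun j : Fin n => (X (some j) : MvPolynomial (Option (Fin n)) κ) + C (b k j) * X none) (cone p c) =
        rename some (cone p c) + C (eval (b k) (cone p c)) * (X none) ^ p := by
    intro k hk
    rw [← mem_span_Linv_iff p hp.ne_zero c, hb_def]
    exact hb k (Finset.ne_of_mem_erase hk)
  -- the linear form `λ = Σ a_l X_l` and the residual substitution `g`
  obtain ⟨lam, hlam_def⟩ : ∃ lam : MvPolynomial (Fin n) κ, lam = ∑ k, C (a k) * X k := ⟨_, rfl⟩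
  obtain ⟨g, hg_def⟩ : ∃ g : Fin n → MvPolynomial (Fin n) κ,
      g = fun j => X j - ∑ k ∈ Finset.univ.erase j₀, C (b k j) * X k := ⟨_, rfl⟩
  have hsum : (fun j => g j + ∑ k ∈ Finset.univ.erase j₀, C (b k j) * (X : Fin n → MvPolynomial (Fin n) κ) k) = X := by
    funext j; rw [hg_def]; simp
  have hpeel : cone p c = aeval g (cone p c) +
      ∑ k ∈ Finset.univ.erase j₀, C (eval (b k) (cone p c)) * (X : Fin n → MvPolynomial (Fin n) κ) k ^ p := by
    have h := linv_peel (cone p c) b (X : Fin n → MvPolynomial (Fin n) κ) (Finset.univ.erase j₀) hbL g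
    rw [hsum, aeval_X_left_apply] at h
    exact h
  -- `g` is the line through `e_{j₀}` with parameter `λ`
  have hg : g = fun j => C ((fun l => if j₀ = l then (1 : κ) else 0) j) * lam := by
    funext j
    rw [hg_def, hlam_def, hb_def]
    simp only []
    by_cases hj : j₀ = j
    · subst hj
      rw [if_pos rfl, C_1, one_mul]
      rw [Finset.sum_congr rfl (g := fun k => -(C (a k) * (X k : MvPolynomial (Fin n) κ)))
        (fun k hk => by rw [if_neg (Finset.ne_of_mem_erase hk), mul_one, zero_sub, C_neg, neg_mul])]
      rw [Finset.sum_neg_distrib, sub_neg_eq_add, ← Finset.add_sum_erase _ _ (Finset.mem_univ j₀), ha₀, C_1,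
        one_mul]
    · rw [if_neg hj, C_0, zero_mul]
      rw [Finset.sum_congr rfl (g := fun k => if k = j then (X k : MvPolynomial (Fin n) κ) else 0)
        (fun k _ => by rw [mul_zero, sub_zero]; split_ifs <;> simp)]
      rw [Finset.sum_ite_eq', if_pos (Finset.mem_erase.mpr ⟨fun h => hj h.symm, Finset.mem_univ j⟩), sub_self]
  have hline : aeval g (cone p c) = C (eval (fun l => if j₀ = l then (1 : κ) else 0) (cone p c)) * lam ^ p := by
    rw [hg]
    exact aeval_smul_line (cone p c) (degree_of_coeff_cone_ne_zero p c) _ lam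
  have hlam : lam ^ p = ∑ k, C (a k ^ p) * (X k : MvPolynomial (Fin n) κ) ^ p := by
    rw [hlam_def, sum_pow_char]
    exact Finset.sum_congr rfl fun k _ => by rw [mul_pow, C_pow]
  -- compare the coefficients of `X^A`
  have hc := congrArg (coeff m) hpeel
  rw [hline, hlam, coeff_add, coeff_C_mul, coeff_frobeniusForm_eq_zero p Finset.univ (fun k => a k ^ p) m hnot,
    coeff_frobeniusForm_eq_zero p (Finset.univ.erase j₀) (fun k => eval (b k) (cone p c)) m hnot, mul_zero,
    add_zero, hcoeff] at hc
  exact hA hc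

end Summit.ResolutionOfSingularities.ResolutionOfSingularities.Theorems.NoPeriodicIsolatedAtom.RidgeRank

end
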